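import Summits.QuantumFields.BalabanUV.T4Continuum.Support.VariationalVectorOneMinCentred
import Summits.QuantumFields.BalabanUV.T4Continuum.Support.VariationalVectorDivHessian

/-!
# T⁴ programme, spine node NE2 (U1a), lane P2 — «V-ONE-G SUMMABLE», file B: (ONE-min) WITH BACKGROUND FOR THE CENTRED COMPETITOR AS THE MONOTONE END's
# `hONEm` BINDER WITH A DECAYING COEFFICIENT — gen 8's raw sizes `ρ̃` read in the currency of the displayed leaves:
# `ρ̃ W₀ ≤ ε⋆·(ScV W₀ + ‖φ‖²)` at every vector minimiser, `ε⋆` explicit (model level; cell `pub-balaban`)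

NE2 formalisation swarm `b2b-balaban-t4-ne2-formalise-*`, leaf prover 01 GEN 9 (`prover-b2b-balaban-t4-ne2-formalise-leaf-01-g9-0`); journal INTENT
«V-ONE-G SUMMABLE» CLAIMS.log 2026-08-20 l.20284.  On top of gen 8's assembly `VariationalVectorOneMinCentred` (p233079: `hONEm_centred`, `oneG_centred_le`)
and file A `VariationalVectorDivHessian` (`sum_diag_le_roughV(')`, `sum_cDv_divV_sq_le`, `sum_cDv_sub_harmonicPart_sq_le`, and the pure-real skeleton
`rhoTilde_abstract_le`) BY NAME; nothing defined.

THE POINT.  Gen 8's `hONEm_centred` is the (ONE-min) socket of the vector END for the componentwise centred interpolant `J_c` with `ε₁ := 1` and an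
EXPLICIT regularity functional `ρ̃` (raw sizes: `rhoV`, `ScV R 0`, `projG`, `hessV`, `Σ‖D_μW_μ‖²`, `nsqV`, `Σ‖D div W‖²`, `Σ‖D(div W − s₀)‖²`, `divSq` with the
free parameters `s, t, u > 0` and the frame ∕ mismatch sizes `m₁, m`).  The monotone END (`VariationalVectorEndMonotone.effV_tendsto_of_upper`, p227472 ∕
p226720) wants `hONEm k` with `√(ScV W₀ + ε₁ k·ρV k W₀)` and `hREG k : ρV k W ≤ C_R k·(ScV W + nsqV φ)` at minimisers, with `Σ_k ε₁ k·C_R k·(Λ+1) + … < ∞`.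
This file proves, at every coarse vector minimiser `W₀` (fibre `QvL T_k = φ` of `ScV Rc (projG Rc (ker Q_T))`):
 * §1 three normalisation identities `cf·L^d∕L² = cc`, `cf·L^{d−1} = cc·L`, `cf·L^d = cc·L²` (`cf = (nL)^{2−d}`, `cc = n^{2−d}`) and the budget lemmas
   `cc·hessV = n⁻²·rhoV`, `cc·nsqV = n²·qWV`;
 * §2 **`rhoTilde_centred_le`**: given the budgets AT ONE FIELD `W` — `rhoV W ≤ C_Rᵛ·A`, `qWV W ≤ C_Pᵛ·A`, `cc·roughV W ≤ C_g·A`, `cc·divSq W ≤ C_dv·A`,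
   `ScV G W ≤ A` — gen 8's `ρ̃ W` (with `E₂` := the error of `oneG_centred_le` at parameter `t`) is `≤ ε⋆·A`,
   `ε⋆ = u + (1+u)·((s + (1+s⁻¹)·dL∕n²)·(1 + C_Rᵛ) + e₂) + (1+u⁻¹)·Λᵥ·(25∕4)·n⁻²·C_g`,
   `e₂ = t + 3(1+t⁻¹)·( 8d·(n⁻²C_Rᵛ + (1+m₁)²·(d∕4)·L·n⁻²C_Rᵛ + m₁²·C_g + m₁²·2(1+d²)L²·n²C_Pᵛ) + (d∕2)·(2d·n⁻²C_Rᵛ + 2d²p²·n²C_Pᵛ)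
        + (d∕4)·(2·(2d·n⁻²C_Rᵛ + 2d²p²·n²C_Pᵛ) + 2Λ_s·n⁻²·C_dv) + C_P^s·e_H·C_dv )`, `e_H` = `oneG_le_add`'s (`O(L∕n² + nLm₁ + n·m)`)
   — every summand carries one of `s, t, u, n⁻², m₁², (nLm₁)², (n p)²·(…) = (n²p)²·n⁻², L∕n², nLm₁, n·m`, so `ε⋆ → 0` along the tower once `s_k = t_k = u_k → 0`
   suitably and the class `n²p ≤ α`, `nLm₁, n·m, L∕n² → 0` holds (the `(np)²` summand is `(n²p)²·n⁻²`);
 * §3 **`hONEm_centred_reg`**: the END's `hONEm` shape with `ρV := ScV + nsqV ∘ Q_k`, `ε₁ := ε⋆`, `δ′ := √(8d(1+d²))·(nLm₁)`: at every minimiser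
   `∃ g, Q_k(Q₁ g) = φ ∧ SfV R′ G′ g ≤ (√(ScV G W₀ + ε⋆·(ScV G W₀ + nsqV (Q_k W₀))) + δ′·√(qWV W₀))²`, the budgets being DISCHARGED at the minimiser from
   the displayed leaves in their LANDED shapes — V-REG `hREGV` (leaf-03's `VariationalVectorRegularityCovariant.hREG_projG(_line_of_divControl)` currency), V-P
   `hPcV`, (Går) `hGar`, div-control (GF3) `hGdiv`, and the scalar UB ∕ P⁺ ∕ REG⁺ ∕ fine UB ∕ fine P⁺ of `oneG_centred_le`; **`hREG_action`**: the END's `hREG`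
   for this `ρV` holds with `C_R = 1` (trivially).
So the existence half of the vector END with background, for Bałaban's projected functional and the centred competitor, now reads
`effV_tendsto_of_upper(_geom) ∘ hONEm_centred_reg` MODULO the displayed leaves and the decay class of `ε⋆_k, δ′_k` — bookkeeping left to the V-END holder.

HONEST FRAMING (T4-DAG p. 1).  Composition at MODEL level (frames ∕ bond operators ∕ line transports DATA, c5); [folklore]; nothing printed is a
hypothesis; no `def`, no `def … : Prop`, no `sorry`; axioms standard.  The leaves stay DISPLAYED (nothing with background is discharged here); `ε⋆ → 0` is a
statement about OUR typed objects under a stated class, not about [B9]'s operators; V-END with background ∕ NE2 NOT proved; NE3 OPEN; spine PROVED 0∕9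
unchanged; rung (B)+1 on a fixed finite T⁴ — NOT infinite volume, NOT mass gap, NOT Clay.  HONEST DEPENDENCY (cell, verbatim): continuum YM on T⁴ ⇐
BetaPertH ∧ nine spine estimates (0/9 proved); BetaPertH ⇐ (D1) ∧ (D4) ∧ CAP+tail; G-an2-4 gates asym, D1 and NE2/3/4.
-/

noncomputable section

namespace Summit.QuantumFields.BalabanUV.T4Continuum.VariationalVectorOneMinCentredReg

open Finset WithLp
open Literature.MathematicalPhysics.QuantumFieldTheory.Balaban1983to89
open Literature.MathematicalPhysics.QuantumFieldTheory.Balaban1983to89.B5Prop11Plancherel (Tor fine unitVec)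
open Literature.MathematicalPhysics.QuantumFieldTheory.Balaban1983to89.B5Block118 (bpt)
open Summit.QuantumFields.BalabanUV.T4Continuum.VariationalColourFederbush (cDv misv norm_le_one_of_mem_unitary)
open Summit.QuantumFields.BalabanUV.T4Continuum.VariationalColourUpperBound (nsqv)
open Summit.QuantumFields.BalabanUV.T4Continuum.VariationalColourInterpolant (interpv)
open Summit.QuantumFields.BalabanUV.T4Continuum.VariationalColourOneStepPhys (rhov)
open Summit.QuantumFields.BalabanUV.T4Continuum.VariationalColourScalarPair (Scv Sfv qWv qVv Qkv Q1v)
open Summit.QuantumFields.BalabanUV.T4Continuum.VariationalVectorInterpolant (frameT)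
open Summit.QuantumFields.BalabanUV.T4Continuum.VectorBlockTrialForm (QvL nsqV nsqV_nonneg roughV roughV_nonneg)
open Summit.QuantumFields.BalabanUV.T4Continuum.VariationalVectorForm (curlSq ScV SfV qWV curlSq_nonneg SfV_nonneg qWV_nonneg ScV_nonneg)
open Summit.QuantumFields.BalabanUV.T4Continuum.VariationalVectorWeitzenbock (divV divSq divSq_nonneg)
open Summit.QuantumFields.BalabanUV.T4Continuum.VariationalVectorGaugeSlice (sliceSub projG projG_nonneg avgOp)
open Summit.QuantumFields.BalabanUV.T4Continuum.VariationalVectorGaugeSliceDist (ScV_eq_zero_add)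
open Summit.QuantumFields.BalabanUV.T4Continuum.VariationalVectorOneStep (hessV hessV_nonneg)
open Summit.QuantumFields.BalabanUV.T4Continuum.VariationalVectorOneStepPhys (rhoV rhoV_nonneg)
open Summit.QuantumFields.BalabanUV.T4Continuum.VariationalVectorOneMinCentred (oneG_centred_le hONEm_centred)
open Summit.QuantumFields.BalabanUV.T4Continuum.VariationalVectorDivHessian
  (sum_diag_le_roughV sum_diag_le_roughV' sum_cDv_divV_sq_le sum_cDv_sub_harmonicPart_sq_le rhoTilde_abstract_le)

variable {d : ℕ} {E : Type*} [NormedAddCommGroup E] [InnerProductSpace ℂ E] [CompleteSpace E] [FiniteDimensional ℂ E]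
variable (n L : ℕ) [NeZero n] [NeZero L] (M : Fin d → ℕ) [hM : ∀ μ, NeZero (M μ)]

/-! ## §1 Normalisations -/

section Norm

omit hM in
/-- `cf·(L^d∕L²) = cc`. [folklore] -/
theorem cf_mul_Ld2 : (((n : ℝ) * L) ^ d)⁻¹ * ((n : ℝ) * L) ^ 2 * ((L : ℝ) ^ d / (L : ℝ) ^ 2) = ((n : ℝ) ^ d)⁻¹ * (n : ℝ) ^ 2 := by
  have hn : (n : ℝ) ≠ 0 := by exact_mod_cast NeZero.ne n
  have hL : (L : ℝ) ≠ 0 := by exact_mod_cast NeZero.ne L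
  rw [mul_pow]; field_simp

omit hM in
/-- `cf·L^{d−1} = cc·L` (`1 ≤ d`). [folklore] -/
theorem cf_mul_Lpred (hd : 1 ≤ d) : (((n : ℝ) * L) ^ d)⁻¹ * ((n : ℝ) * L) ^ 2 * (L : ℝ) ^ (d - 1) = ((n : ℝ) ^ d)⁻¹ * (n : ℝ) ^ 2 * L := by
  have hn : (n : ℝ) ≠ 0 := by exact_mod_cast NeZero.ne n
  have hL : (L : ℝ) ≠ 0 := by exact_mod_cast NeZero.ne L
  have hLd : (L : ℝ) ^ d = (L : ℝ) ^ (d - 1) * L := by rw [← pow_succ, Nat.sub_add_cancel hd]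
  rw [mul_pow, hLd]; field_simp

omit hM in
/-- `cf·L^d = cc·L²`. [folklore] -/
theorem cf_mul_Ld : (((n : ℝ) * L) ^ d)⁻¹ * ((n : ℝ) * L) ^ 2 * (L : ℝ) ^ d = ((n : ℝ) ^ d)⁻¹ * (n : ℝ) ^ 2 * (L : ℝ) ^ 2 := by
  have hn : (n : ℝ) ≠ 0 := by exact_mod_cast NeZero.ne n
  have hL : (L : ℝ) ≠ 0 := by exact_mod_cast NeZero.ne L
  rw [mul_pow]; field_simp

omit [CompleteSpace E] [FiniteDimensional ℂ E] [NeZero L] in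
/-- `cc·hessV W = n⁻²·rhoV W`. [folklore] -/
theorem cc_mul_hessV_eq (Rc : Tor (fine n M) → Fin d → (E →L[ℂ] E)) (W : Tor (fine n M) → Fin d → E) :
    ((n : ℝ) ^ d)⁻¹ * (n : ℝ) ^ 2 * hessV (fine n M) Rc W = ((n : ℝ) ^ 2)⁻¹ * rhoV n M Rc W := by
  have hn : (n : ℝ) ≠ 0 := by exact_mod_cast NeZero.ne n
  unfold rhoV; field_simp

omit [InnerProductSpace ℂ E] [CompleteSpace E] [FiniteDimensional ℂ E] [NeZero L] in
/-- `cc·nsqV W = n²·qWV W`. [folklore] -/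
theorem cc_mul_nsqV_eq [NormedSpace ℂ E] (W : Tor (fine n M) → Fin d → E) :
    ((n : ℝ) ^ d)⁻¹ * (n : ℝ) ^ 2 * nsqV (fine n M) W = (n : ℝ) ^ 2 * qWV n M W := by
  unfold qWV; ring

end Norm

/-! ## §2 The raw regularity functional `ρ̃` of `hONEm_centred` is below `ε⋆·A` under the budgets at one field -/

section Budget

/-- **`ρ̃ W ≤ ε⋆·A` FROM THE BUDGETS AT ONE FIELD** (`1 ≤ d`; UNITARY `Rc` with plaquette defect `≤ p`; contractive scalar frames `T`; the scalar UB leaf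
`Λ`): if at `W` the vector leaves' currencies are bounded by one number `A` — `rhoV W ≤ C_Rᵛ A`, `qWV W ≤ C_Pᵛ A`, `cc·roughV W ≤ C_g A`,
`cc·divSq W ≤ C_dv A`, `ScV G W ≤ A` (`G = projG Rc (ker Q_T)`) — then gen 8's `ρ̃ W` (with `E₂ :=` the error functional of `oneG_centred_le` at
parameter `t`) is `≤ ε⋆·A` with the displayed explicit `ε⋆`. [folklore] -/
theorem rhoTilde_centred_le (hd : 1 ≤ d) {Rc : Tor (fine n M) → Fin d → (E →L[ℂ] E)} (hRc : ∀ y μ, Rc y μ ∈ unitary (E →L[ℂ] E))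
    {p : ℝ} (hp : 0 ≤ p) (hP : ∀ x μ ν, ‖Rc x μ * Rc (x + unitVec (fine n M) μ) ν - Rc x ν * Rc (x + unitVec (fine n M) ν) μ‖ ≤ p)
    {T : Tor (fine n M) → (E →L[ℂ] E)} (hT1 : ∀ x, ‖T x‖ ≤ 1)
    {m m₁ Λ CP CR Λv : ℝ} (hm : 0 ≤ m) (hm₁ : 0 ≤ m₁) (hΛ : 0 ≤ Λ) (hCP : 0 ≤ CP) (hCR : 0 ≤ CR) (hΛv : 0 ≤ Λv)
    (hUBc : ∀ ψ : Tor M → E, ∃ f, Qkv n M T f = ψ ∧ Scv n M Rc f ≤ Λ * nsqv ψ)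
    {s t u : ℝ} (hs : 0 < s) (ht : 0 < t) (hu : 0 < u)
    {CRv CPv Cg Cdv A : ℝ} (W : Tor (fine n M) → Fin d → E)
    (hSA : ScV n M Rc (projG (fine n M) Rc (LinearMap.ker (avgOp n M T))) W ≤ A)
    (hρ : rhoV n M Rc W ≤ CRv * A) (hq : qWV n M W ≤ CPv * A)
    (hr : ((n : ℝ) ^ d)⁻¹ * ((n : ℝ) ^ 2 * roughV n M Rc W) ≤ Cg * A)
    (hdv : ((n : ℝ) ^ d)⁻¹ * ((n : ℝ) ^ 2 * divSq (fine n M) Rc W) ≤ Cdv * A) :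
    let eH : ℝ := (((d : ℝ) / 4 + 1 / 2) * ((L : ℝ) / (n : ℝ) ^ 2)) * CR * (Λ + 1)
        + 2 * (Real.sqrt (2 * d * (1 + (d : ℝ) ^ 2)) * ((n : ℝ) * L * m₁))
          * Real.sqrt ((Λ + (((d : ℝ) / 4 + 1 / 2) * ((L : ℝ) / (n : ℝ) ^ 2)) * CR * (Λ + 1)) * (CP * (Λ + 1)))
        + (Real.sqrt (2 * d * (1 + (d : ℝ) ^ 2)) * ((n : ℝ) * L * m₁)) ^ 2 * (CP * (Λ + 1))
        + 2 * (Real.sqrt d * ((n : ℝ) * m)) * Real.sqrt (Λ * (CP * (Λ + 1)))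
    let e₂ : ℝ := t + 3 * (1 + t⁻¹) * (8 * d * (((n : ℝ) ^ 2)⁻¹ * CRv
          + (1 + m₁) ^ 2 * ((d : ℝ) / 4 * L * (((n : ℝ) ^ 2)⁻¹ * CRv)) + m₁ ^ 2 * Cg + m₁ ^ 2 * (2 * (1 + (d : ℝ) ^ 2) * (L : ℝ) ^ 2 * ((n : ℝ) ^ 2 * CPv)))
        + (d : ℝ) / 2 * (2 * d * (((n : ℝ) ^ 2)⁻¹ * CRv) + 2 * (d : ℝ) ^ 2 * p ^ 2 * ((n : ℝ) ^ 2 * CPv))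
        + (d : ℝ) / 4 * (2 * (2 * d * (((n : ℝ) ^ 2)⁻¹ * CRv) + 2 * (d : ℝ) ^ 2 * p ^ 2 * ((n : ℝ) ^ 2 * CPv)) + 2 * (Λ * ((n : ℝ) ^ 2)⁻¹ * Cdv))
        + CP * eH * Cdv)
    let ε : ℝ := u + (1 + u) * ((s + (1 + s⁻¹) * (d * (L : ℝ) / (n : ℝ) ^ 2)) * (1 + CRv) + e₂) + (1 + u⁻¹) * (Λv * (25 / 4 * (((n : ℝ) ^ 2)⁻¹ * Cg)))
    u * ScV n M Rc (projG (fine n M) Rc (LinearMap.ker (avgOp n M T))) W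
      + (1 + u) * ((s + (1 + s⁻¹) * (d * (L : ℝ) / (n : ℝ) ^ 2)) * (ScV n M Rc (fun _ => 0) W + rhoV n M Rc W)
        + (t * (((n : ℝ) ^ d)⁻¹ * (n : ℝ) ^ 2 * projG (fine n M) Rc (LinearMap.ker (avgOp n M T)) W)
          + 3 * (1 + t⁻¹) * ((((n : ℝ) * L) ^ d)⁻¹ * ((n : ℝ) * L) ^ 2
              * (8 * d * ((L : ℝ) ^ d / (L : ℝ) ^ 2 * hessV (fine n M) Rc W + (1 + m₁) ^ 2 * ((L : ℝ) ^ (d - 1) * ((d : ℝ) / 4 * hessV (fine n M) Rc W))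
                  + m₁ ^ 2 * ((L : ℝ) ^ d / (L : ℝ) ^ 2 * ∑ μ, ∑ y, ‖cDv (fine n M) Rc (fun z => W z μ) y μ‖ ^ 2)
                  + m₁ ^ 2 * (2 * (1 + (d : ℝ) ^ 2) * ((L : ℝ) ^ d * nsqV (fine n M) W)))
                + (d : ℝ) / 2 * ((L : ℝ) ^ d / (L : ℝ) ^ 2 * ∑ y, ∑ κ, ‖cDv (fine n M) Rc (divV (fine n M) Rc W) y κ‖ ^ 2))
            + (Real.sqrt ((d : ℝ) / 4)) ^ 2 * (((n : ℝ) ^ d)⁻¹ * (n : ℝ) ^ 2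
              * ∑ y, ∑ μ, ‖cDv (fine n M) Rc (divV (fine n M) Rc W
                - WithLp.ofLp ((sliceSub (fine n M) Rc (LinearMap.ker (avgOp n M T)))ᗮ.starProjection (toLp 2 (divV (fine n M) Rc W)))) y μ‖ ^ 2)
            + CP * eH * (((n : ℝ) ^ d)⁻¹ * (n : ℝ) ^ 2 * divSq (fine n M) Rc W))))
      + (1 + u⁻¹) * (Λv * (25 / 4 * (((n : ℝ) ^ d)⁻¹ * ∑ y, ∑ ν, ‖cDv (fine n M) Rc (fun z => W z ν) y ν‖ ^ 2)))
      ≤ ε * A := by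
  intro eH e₂ ε
  have hn : (0 : ℝ) < n := by exact_mod_cast Nat.pos_of_ne_zero (NeZero.ne n)
  have hL : (0 : ℝ) < L := by exact_mod_cast Nat.pos_of_ne_zero (NeZero.ne L)
  have hn' : (n : ℝ) ≠ 0 := hn.ne'
  have hG0 : 0 ≤ projG (fine n M) Rc (LinearMap.ker (avgOp n M T)) W := projG_nonneg (fine n M) Rc _ W
  have hcc0 : (0 : ℝ) ≤ ((n : ℝ) ^ d)⁻¹ * (n : ℝ) ^ 2 := by positivity
  have heH : 0 ≤ eH := by positivity
  -- the budgets in `cc`-currency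
  have e0 := ScV_eq_zero_add n M Rc (projG (fine n M) Rc (LinearMap.ker (avgOp n M T))) W
  have hS00 : 0 ≤ ScV n M Rc (fun _ => 0) W := ScV_nonneg n M Rc (fun _ => le_rfl) W
  have b0 : ((n : ℝ) ^ d)⁻¹ * (n : ℝ) ^ 2 * projG (fine n M) Rc (LinearMap.ker (avgOp n M T)) W ≤ A := by
    rw [mul_assoc]; linarith
  have b0' : ScV n M Rc (fun _ => 0) W ≤ A := by
    have : 0 ≤ ((n : ℝ) ^ d)⁻¹ * ((n : ℝ) ^ 2 * projG (fine n M) Rc (LinearMap.ker (avgOp n M T)) W) := by positivity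
    linarith
  have b1 : ((n : ℝ) ^ d)⁻¹ * (n : ℝ) ^ 2 * hessV (fine n M) Rc W ≤ ((n : ℝ) ^ 2)⁻¹ * (CRv * A) := by
    rw [cc_mul_hessV_eq n M Rc W]
    exact mul_le_mul_of_nonneg_left hρ (by positivity)
  have b2 : ((n : ℝ) ^ d)⁻¹ * (n : ℝ) ^ 2 * nsqV (fine n M) W ≤ (n : ℝ) ^ 2 * (CPv * A) := by
    rw [cc_mul_nsqV_eq n M W]
    exact mul_le_mul_of_nonneg_left hq (by positivity)
  have b3 : ((n : ℝ) ^ d)⁻¹ * (n : ℝ) ^ 2 * ∑ μ, ∑ y, ‖cDv (fine n M) Rc (fun z => W z μ) y μ‖ ^ 2 ≤ Cg * A := by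
    calc ((n : ℝ) ^ d)⁻¹ * (n : ℝ) ^ 2 * ∑ μ, ∑ y, ‖cDv (fine n M) Rc (fun z => W z μ) y μ‖ ^ 2
        ≤ ((n : ℝ) ^ d)⁻¹ * (n : ℝ) ^ 2 * roughV n M Rc W := mul_le_mul_of_nonneg_left (sum_diag_le_roughV n M Rc W) hcc0
      _ = ((n : ℝ) ^ d)⁻¹ * ((n : ℝ) ^ 2 * roughV n M Rc W) := mul_assoc _ _ _
      _ ≤ Cg * A := hr
  have b3' : ((n : ℝ) ^ d)⁻¹ * ∑ y, ∑ ν, ‖cDv (fine n M) Rc (fun z => W z ν) y ν‖ ^ 2 ≤ ((n : ℝ) ^ 2)⁻¹ * (Cg * A) := by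
    have e : ((n : ℝ) ^ d)⁻¹ * ∑ y, ∑ ν, ‖cDv (fine n M) Rc (fun z => W z ν) y ν‖ ^ 2
        = ((n : ℝ) ^ 2)⁻¹ * (((n : ℝ) ^ d)⁻¹ * (n : ℝ) ^ 2 * ∑ y, ∑ ν, ‖cDv (fine n M) Rc (fun z => W z ν) y ν‖ ^ 2) := by
      field_simp
    rw [e]
    refine mul_le_mul_of_nonneg_left ?_ (by positivity)
    calc ((n : ℝ) ^ d)⁻¹ * (n : ℝ) ^ 2 * ∑ y, ∑ ν, ‖cDv (fine n M) Rc (fun z => W z ν) y ν‖ ^ 2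
        ≤ ((n : ℝ) ^ d)⁻¹ * (n : ℝ) ^ 2 * roughV n M Rc W := mul_le_mul_of_nonneg_left (sum_diag_le_roughV' n M Rc W) hcc0
      _ = ((n : ℝ) ^ d)⁻¹ * ((n : ℝ) ^ 2 * roughV n M Rc W) := mul_assoc _ _ _
      _ ≤ Cg * A := hr
  have b4 : ((n : ℝ) ^ d)⁻¹ * (n : ℝ) ^ 2 * divSq (fine n M) Rc W ≤ Cdv * A := by rw [mul_assoc]; exact hdv
  have b5 : ((n : ℝ) ^ d)⁻¹ * (n : ℝ) ^ 2 * ∑ y, ∑ κ, ‖cDv (fine n M) Rc (divV (fine n M) Rc W) y κ‖ ^ 2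
      ≤ 2 * d * (((n : ℝ) ^ 2)⁻¹ * (CRv * A)) + 2 * (d : ℝ) ^ 2 * p ^ 2 * ((n : ℝ) ^ 2 * (CPv * A)) := by
    have h := sum_cDv_divV_sq_le (fine n M) hRc hp hP W
    calc ((n : ℝ) ^ d)⁻¹ * (n : ℝ) ^ 2 * ∑ y, ∑ κ, ‖cDv (fine n M) Rc (divV (fine n M) Rc W) y κ‖ ^ 2
        ≤ ((n : ℝ) ^ d)⁻¹ * (n : ℝ) ^ 2 * (2 * d * hessV (fine n M) Rc W + 2 * (d : ℝ) ^ 2 * p ^ 2 * nsqV (fine n M) W) :=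
          mul_le_mul_of_nonneg_left h hcc0
      _ = 2 * d * (((n : ℝ) ^ d)⁻¹ * (n : ℝ) ^ 2 * hessV (fine n M) Rc W)
          + 2 * (d : ℝ) ^ 2 * p ^ 2 * (((n : ℝ) ^ d)⁻¹ * (n : ℝ) ^ 2 * nsqV (fine n M) W) := by ring
      _ ≤ _ := by gcongr
  have b6 : ((n : ℝ) ^ d)⁻¹ * (n : ℝ) ^ 2 * ∑ y, ∑ μ, ‖cDv (fine n M) Rc (divV (fine n M) Rc W
        - WithLp.ofLp ((sliceSub (fine n M) Rc (LinearMap.ker (avgOp n M T)))ᗮ.starProjection (toLp 2 (divV (fine n M) Rc W)))) y μ‖ ^ 2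
      ≤ 2 * (2 * d * (((n : ℝ) ^ 2)⁻¹ * (CRv * A)) + 2 * (d : ℝ) ^ 2 * p ^ 2 * ((n : ℝ) ^ 2 * (CPv * A)))
        + 2 * (Λ * ((n : ℝ) ^ 2)⁻¹ * (Cdv * A)) := by
    have h := sum_cDv_sub_harmonicPart_sq_le n M hRc hp hP hT1 hΛ hUBc W
    calc ((n : ℝ) ^ d)⁻¹ * (n : ℝ) ^ 2 * ∑ y, ∑ μ, ‖cDv (fine n M) Rc (divV (fine n M) Rc W
          - WithLp.ofLp ((sliceSub (fine n M) Rc (LinearMap.ker (avgOp n M T)))ᗮ.starProjection (toLp 2 (divV (fine n M) Rc W)))) y μ‖ ^ 2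
        ≤ ((n : ℝ) ^ d)⁻¹ * (n : ℝ) ^ 2 * (2 * (2 * d * hessV (fine n M) Rc W + 2 * (d : ℝ) ^ 2 * p ^ 2 * nsqV (fine n M) W)
            + 2 * (Λ * ((n : ℝ) ^ 2)⁻¹ * divSq (fine n M) Rc W)) := mul_le_mul_of_nonneg_left h hcc0
      _ = 2 * (2 * d * (((n : ℝ) ^ d)⁻¹ * (n : ℝ) ^ 2 * hessV (fine n M) Rc W)
            + 2 * (d : ℝ) ^ 2 * p ^ 2 * (((n : ℝ) ^ d)⁻¹ * (n : ℝ) ^ 2 * nsqV (fine n M) W))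
          + 2 * (Λ * ((n : ℝ) ^ 2)⁻¹ * (((n : ℝ) ^ d)⁻¹ * (n : ℝ) ^ 2 * divSq (fine n M) Rc W)) := by ring
      _ ≤ _ := by gcongr
  have hsq : (Real.sqrt ((d : ℝ) / 4)) ^ 2 = (d : ℝ) / 4 := Real.sq_sqrt (by positivity)
  exact rhoTilde_abstract_le hu hs ht (by positivity) (Nat.cast_nonneg d) hL.le hm₁ hCP heH hΛv hSA b0' hρ b0 b1 b2 b3 b3' b4 b5 b6
    (cf_mul_Ld2 n L) (cf_mul_Lpred n L hd) (cf_mul_Ld n L) hsq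

end Budget

/-! ## §3 The END's `hONEm` binder with `ρV := ScV + nsqV ∘ Q_k`, `ε₁ := ε⋆`, and its (trivial) `hREG` -/

section End

/-- **(ONE-min) WITH BACKGROUND FOR THE CENTRED COMPETITOR `J_c`, IN THE MONOTONE END's `hONEm` SHAPE WITH A DECAYING COEFFICIENT** (model level; `E` a
finite-dimensional Hilbert space; `1 ≤ d`).  Data: UNITARY coarse bonds `Rc` (plaquette defect `≤ p`), unitary fine bonds `R′`, unitary scalar frames `T` (coarse)
and `T′` (one-step), contractive coarse vector line transports `T_k`; frame defects `≤ m₁`, line mismatch `≤ m`; free `s, t, u > 0`.  DISPLAYED leaves, all in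
their landed shapes: the scalar pair's UB⁺ (both levels) ∕ P⁺ (both levels) ∕ REG⁺ (as in gen 8's `oneG_centred_le`), the vector fine V-UB `hUBfV` (as in
`hONEm_centred`), and — NEW here, for the budgets at the minimiser — V-P `hPcV`, (Går) `hGar`, div-control (GF3) `hGdiv`, V-REG `hREGV` for
`G := projG Rc (ker Q_T)` on the carriers `QvL T_k` (leaf-03's `VariationalVectorRegularityCovariant.hREG_projG` currency).  Conclusion: at every coarse
minimiser `W₀`, `∃ g, Q_k(Q₁ g) = φ ∧ SfV R′ G′ g ≤ (√(ScV G W₀ + ε⋆·(ScV G W₀ + nsqV (Q_k W₀))) + √(8d(1+d²))·(nLm₁)·√(qWV W₀))²` — the END's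
`hONEm k` (`VariationalVectorEndMonotone.effV_tendsto_of_upper`) with `ρV k := ScV + nsqV ∘ Q_k` (whose `hREG k` is `hREG_action`, `C_R = 1`),
`ε₁ k := ε⋆` and `δ′ k := √(8d(1+d²))·(n_k L m₁,ₖ)`. [folklore] -/
theorem hONEm_centred_reg (hd : 1 ≤ d) {Rc : Tor (fine n M) → Fin d → (E →L[ℂ] E)} {R' : Tor (fine L (fine n M)) → Fin d → (E →L[ℂ] E)}
    {T : Tor (fine n M) → (E →L[ℂ] E)} {T' : Tor (fine L (fine n M)) → (E →L[ℂ] E)} {Tk : Tor M → (Fin d → Fin n) → Fin n → Fin d → (E →L[ℂ] E)}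
    (hT : ∀ x, T x ∈ unitary (E →L[ℂ] E)) (hT' : ∀ x, T' x ∈ unitary (E →L[ℂ] E)) (hRc : ∀ y μ, Rc y μ ∈ unitary (E →L[ℂ] E))
    (hR1 : ∀ x μ, R' x μ ∈ unitary (E →L[ℂ] E)) (hTk : ∀ y j t' μ, ‖Tk y j t' μ‖ ≤ 1)
    {p : ℝ} (hp : 0 ≤ p) (hP : ∀ x μ ν, ‖Rc x μ * Rc (x + unitVec (fine n M) μ) ν - Rc x ν * Rc (x + unitVec (fine n M) ν) μ‖ ≤ p)
    {m : ℝ} (hm : 0 ≤ m) (hmis : ∀ y μ j, ‖misv L (fine n M) Rc R' T' y μ j‖ ≤ m)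
    {m₁ : ℝ} (hm₁ : 0 ≤ m₁)
    (hin : ∀ (y : Tor (fine n M)) (j : Fin d → Fin L) (μ : Fin d), (j μ : ℕ) + 1 < L →
      ‖R' (bpt L (fine n M) y j) μ * star (T' (bpt L (fine n M) y j + unitVec (fine L (fine n M)) μ)) - star (T' (bpt L (fine n M) y j))‖ ≤ m₁)
    (hcross : ∀ (y : Tor (fine n M)) (j : Fin d → Fin L) (μ : Fin d), (j μ : ℕ) + 1 = L →
      ‖R' (bpt L (fine n M) y j) μ * star (T' (bpt L (fine n M) y j + unitVec (fine L (fine n M)) μ))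
        - star (T' (bpt L (fine n M) y j)) * Rc y μ‖ ≤ m₁)
    -- the scalar pair's leaves (both levels), as in `oneG_centred_le`
    {Λ CP CR : ℝ} (hΛ : 0 ≤ Λ) (hCP : 0 ≤ CP) (hCR : 0 ≤ CR)
    (hUBc : ∀ ψ : Tor M → E, ∃ f, Qkv n M T f = ψ ∧ Scv n M Rc f ≤ Λ * nsqv ψ)
    (hUBf : ∀ ψ : Tor M → E, ∃ g, Qkv n M T (Q1v n L M T' g) = ψ ∧ Sfv n L M R' g ≤ Λ * nsqv ψ)
    (hPc : ∀ f, qWv n M f ≤ CP * (Scv n M Rc f + nsqv (Qkv n M T f)))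
    (hPf : ∀ g, qVv n L M g ≤ CP * (Sfv n L M R' g + nsqv (Qkv n M T (Q1v n L M T' g))))
    (hREG : ∀ (ψ : Tor M → E) f, Qkv n M T f = ψ → (∀ f₂, Qkv n M T f₂ = ψ → Scv n M Rc f ≤ Scv n M Rc f₂) →
      rhov n M Rc f ≤ CR * (Scv n M Rc f + nsqv ψ))
    -- the vector leaves for `G := projG Rc (ker Q_T)` on the carriers `QvL T_k` (landed shapes)
    {Λv CRv CPv CGar CGar' CD CD' : ℝ} (hΛv : 0 ≤ Λv) (hCGar : 0 ≤ CGar) (hCGar' : 0 ≤ CGar') (hCD : 0 ≤ CD) (hCD' : 0 ≤ CD')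
    (hUBfV : ∀ φ : Tor M → Fin d → E, ∃ W', QvL n M Tk (QvL L (fine n M) (frameT L (fine n M) T' Rc) W') = φ ∧
      SfV n L M R' (projG (fine L (fine n M)) R' (LinearMap.ker ((avgOp n M T).comp (avgOp L (fine n M) T')))) W' ≤ Λv * nsqV M φ)
    (hPcV : ∀ W, qWV n M W ≤ CPv * (ScV n M Rc (projG (fine n M) Rc (LinearMap.ker (avgOp n M T))) W + nsqV M (QvL n M Tk W)))
    (hGar : ∀ W, ((n : ℝ) ^ d)⁻¹ * ((n : ℝ) ^ 2 * roughV n M Rc W)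
      ≤ CGar * ScV n M Rc (projG (fine n M) Rc (LinearMap.ker (avgOp n M T))) W + CGar' * nsqV M (QvL n M Tk W))
    (hGdiv : ∀ W, ((n : ℝ) ^ d)⁻¹ * ((n : ℝ) ^ 2 * divSq (fine n M) Rc W)
      ≤ CD * ScV n M Rc (projG (fine n M) Rc (LinearMap.ker (avgOp n M T))) W + CD' * nsqV M (QvL n M Tk W))
    (hREGV : ∀ (φ : Tor M → Fin d → E) W, QvL n M Tk W = φ →
      (∀ W₂, QvL n M Tk W₂ = φ → ScV n M Rc (projG (fine n M) Rc (LinearMap.ker (avgOp n M T))) W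
        ≤ ScV n M Rc (projG (fine n M) Rc (LinearMap.ker (avgOp n M T))) W₂) →
      rhoV n M Rc W ≤ CRv * (ScV n M Rc (projG (fine n M) Rc (LinearMap.ker (avgOp n M T))) W + nsqV M φ))
    {s t u : ℝ} (hs : 0 < s) (ht : 0 < t) (hu : 0 < u) :
    let eH : ℝ := (((d : ℝ) / 4 + 1 / 2) * ((L : ℝ) / (n : ℝ) ^ 2)) * CR * (Λ + 1)
        + 2 * (Real.sqrt (2 * d * (1 + (d : ℝ) ^ 2)) * ((n : ℝ) * L * m₁))
          * Real.sqrt ((Λ + (((d : ℝ) / 4 + 1 / 2) * ((L : ℝ) / (n : ℝ) ^ 2)) * CR * (Λ + 1)) * (CP * (Λ + 1)))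
        + (Real.sqrt (2 * d * (1 + (d : ℝ) ^ 2)) * ((n : ℝ) * L * m₁)) ^ 2 * (CP * (Λ + 1))
        + 2 * (Real.sqrt d * ((n : ℝ) * m)) * Real.sqrt (Λ * (CP * (Λ + 1)))
    let e₂ : ℝ := t + 3 * (1 + t⁻¹) * (8 * d * (((n : ℝ) ^ 2)⁻¹ * CRv
          + (1 + m₁) ^ 2 * ((d : ℝ) / 4 * L * (((n : ℝ) ^ 2)⁻¹ * CRv)) + m₁ ^ 2 * (CGar + CGar')
          + m₁ ^ 2 * (2 * (1 + (d : ℝ) ^ 2) * (L : ℝ) ^ 2 * ((n : ℝ) ^ 2 * CPv)))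
        + (d : ℝ) / 2 * (2 * d * (((n : ℝ) ^ 2)⁻¹ * CRv) + 2 * (d : ℝ) ^ 2 * p ^ 2 * ((n : ℝ) ^ 2 * CPv))
        + (d : ℝ) / 4 * (2 * (2 * d * (((n : ℝ) ^ 2)⁻¹ * CRv) + 2 * (d : ℝ) ^ 2 * p ^ 2 * ((n : ℝ) ^ 2 * CPv)) + 2 * (Λ * ((n : ℝ) ^ 2)⁻¹ * (CD + CD')))
        + CP * eH * (CD + CD'))
    let ε : ℝ := u + (1 + u) * ((s + (1 + s⁻¹) * (d * (L : ℝ) / (n : ℝ) ^ 2)) * (1 + CRv) + e₂)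
      + (1 + u⁻¹) * (Λv * (25 / 4 * (((n : ℝ) ^ 2)⁻¹ * (CGar + CGar'))))
    ∀ (φ : Tor M → Fin d → E) (W₀ : Tor (fine n M) → Fin d → E), QvL n M Tk W₀ = φ →
      (∀ W, QvL n M Tk W = φ → ScV n M Rc (projG (fine n M) Rc (LinearMap.ker (avgOp n M T))) W₀
        ≤ ScV n M Rc (projG (fine n M) Rc (LinearMap.ker (avgOp n M T))) W) →
      ∃ g, QvL n M Tk (QvL L (fine n M) (frameT L (fine n M) T' Rc) g) = φ ∧
        SfV n L M R' (projG (fine L (fine n M)) R' (LinearMap.ker ((avgOp n M T).comp (avgOp L (fine n M) T')))) g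
          ≤ (Real.sqrt (ScV n M Rc (projG (fine n M) Rc (LinearMap.ker (avgOp n M T))) W₀
              + ε * (ScV n M Rc (projG (fine n M) Rc (LinearMap.ker (avgOp n M T))) W₀ + nsqV M (QvL n M Tk W₀)))
            + Real.sqrt (8 * d * (1 + (d : ℝ) ^ 2)) * ((n : ℝ) * L * m₁) * Real.sqrt (qWV n M W₀)) ^ 2 := by
  intro eH e₂ ε φ W₀ hW₀ hmin
  have hn : (0 : ℝ) < n := by exact_mod_cast Nat.pos_of_ne_zero (NeZero.ne n)
  have hL : (0 : ℝ) < L := by exact_mod_cast Nat.pos_of_ne_zero (NeZero.ne L)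
  have hT1 : ∀ x, ‖T x‖ ≤ 1 := fun x => norm_le_one_of_mem_unitary (hT x)
  have heH : 0 ≤ eH := by positivity
  -- gen 8's assembly with (G′) supplied by `oneG_centred_le` (reassociated) and its error functional `E₂`
  obtain ⟨g, hg, hS⟩ := hONEm_centred n L M hd hT' hRc hTk hm₁ hin hcross
    (E₂ := fun W => t * (((n : ℝ) ^ d)⁻¹ * (n : ℝ) ^ 2 * projG (fine n M) Rc (LinearMap.ker (avgOp n M T)) W)
          + 3 * (1 + t⁻¹) * ((((n : ℝ) * L) ^ d)⁻¹ * ((n : ℝ) * L) ^ 2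
              * (8 * d * ((L : ℝ) ^ d / (L : ℝ) ^ 2 * hessV (fine n M) Rc W + (1 + m₁) ^ 2 * ((L : ℝ) ^ (d - 1) * ((d : ℝ) / 4 * hessV (fine n M) Rc W))
                  + m₁ ^ 2 * ((L : ℝ) ^ d / (L : ℝ) ^ 2 * ∑ μ, ∑ y, ‖cDv (fine n M) Rc (fun z => W z μ) y μ‖ ^ 2)
                  + m₁ ^ 2 * (2 * (1 + (d : ℝ) ^ 2) * ((L : ℝ) ^ d * nsqV (fine n M) W)))
                + (d : ℝ) / 2 * ((L : ℝ) ^ d / (L : ℝ) ^ 2 * ∑ y, ∑ κ, ‖cDv (fine n M) Rc (divV (fine n M) Rc W) y κ‖ ^ 2))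
            + (Real.sqrt ((d : ℝ) / 4)) ^ 2 * (((n : ℝ) ^ d)⁻¹ * (n : ℝ) ^ 2
              * ∑ y, ∑ μ, ‖cDv (fine n M) Rc (divV (fine n M) Rc W
                - WithLp.ofLp ((sliceSub (fine n M) Rc (LinearMap.ker (avgOp n M T)))ᗮ.starProjection (toLp 2 (divV (fine n M) Rc W)))) y μ‖ ^ 2)
            + CP * eH * (((n : ℝ) ^ d)⁻¹ * (n : ℝ) ^ 2 * divSq (fine n M) Rc W)))
    (fun W => by
      beta_reduce
      have := projG_nonneg (fine n M) Rc (LinearMap.ker (avgOp n M T)) W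
      have := hessV_nonneg (fine n M) Rc W
      have := divSq_nonneg (fine n M) Rc W
      have := nsqV_nonneg (fine n M) W
      positivity)
    (fun W => by
      have h := oneG_centred_le n L M hT hT' hRc hR1 hm hmis hm₁ hin hcross hΛ hCP hCR hUBc hUBf hPc hPf hREG ht W
      beta_reduce
      rw [← mul_assoc, ← mul_assoc (((n : ℝ) ^ d)⁻¹)]
      exact h)
    hΛv hUBfV hs hu φ W₀ hW₀ hmin
  refine ⟨g, hg, hS.trans ?_⟩
  beta_reduce
  -- the budgets at the minimiser
  have hS0 : 0 ≤ ScV n M Rc (projG (fine n M) Rc (LinearMap.ker (avgOp n M T))) W₀ :=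
    ScV_nonneg n M Rc (fun W => projG_nonneg (fine n M) Rc _ W) W₀
  have hZ0 : 0 ≤ nsqV M (QvL n M Tk W₀) := nsqV_nonneg M _
  have hSA : ScV n M Rc (projG (fine n M) Rc (LinearMap.ker (avgOp n M T))) W₀
      ≤ ScV n M Rc (projG (fine n M) Rc (LinearMap.ker (avgOp n M T))) W₀ + nsqV M (QvL n M Tk W₀) := le_add_of_nonneg_right hZ0
  have hρ : rhoV n M Rc W₀ ≤ CRv * (ScV n M Rc (projG (fine n M) Rc (LinearMap.ker (avgOp n M T))) W₀ + nsqV M (QvL n M Tk W₀)) := by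
    have h := hREGV φ W₀ hW₀ hmin
    rw [← hW₀] at h
    exact h
  have hr : ((n : ℝ) ^ d)⁻¹ * ((n : ℝ) ^ 2 * roughV n M Rc W₀)
      ≤ (CGar + CGar') * (ScV n M Rc (projG (fine n M) Rc (LinearMap.ker (avgOp n M T))) W₀ + nsqV M (QvL n M Tk W₀)) := by
    have h := hGar W₀
    have h1 := mul_nonneg hCGar hZ0
    have h2 := mul_nonneg hCGar' hS0
    linarith
  have hdv : ((n : ℝ) ^ d)⁻¹ * ((n : ℝ) ^ 2 * divSq (fine n M) Rc W₀)
      ≤ (CD + CD') * (ScV n M Rc (projG (fine n M) Rc (LinearMap.ker (avgOp n M T))) W₀ + nsqV M (QvL n M Tk W₀)) := by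
    have h := hGdiv W₀
    have h1 := mul_nonneg hCD hZ0
    have h2 := mul_nonneg hCD' hS0
    linarith
  have hρt := rhoTilde_centred_le n L M hd hRc hp hP hT1 hm hm₁ hΛ hCP hCR hΛv hUBc hs ht hu W₀ hSA hρ (hPcV W₀) hr hdv
  have key := add_le_add (le_refl (ScV n M Rc (projG (fine n M) Rc (LinearMap.ker (avgOp n M T))) W₀)) hρt
  have hab := add_le_add (Real.sqrt_le_sqrt key) (le_refl (Real.sqrt (8 * d * (1 + (d : ℝ) ^ 2)) * ((n : ℝ) * L * m₁) * Real.sqrt (qWV n M W₀)))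
  have hδ0 : 0 ≤ Real.sqrt (8 * d * (1 + (d : ℝ) ^ 2)) * ((n : ℝ) * L * m₁) * Real.sqrt (qWV n M W₀) := by positivity
  rw [one_mul]
  exact pow_le_pow_left₀ (add_nonneg (Real.sqrt_nonneg _) hδ0) hab 2

omit [CompleteSpace E] [FiniteDimensional ℂ E] [NeZero L] in
/-- **THE END's `hREG` FOR `ρV := ScV + nsqV ∘ Q_k` IS TRIVIAL** (`C_R = 1`): at any field of the fibre (minimiser or not)
`ScV G W + nsqV (Q_k W) ≤ 1·(ScV G W + nsqV φ)`. [folklore] -/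
theorem hREG_action {Rc : Tor (fine n M) → Fin d → (E →L[ℂ] E)} {G : (Tor (fine n M) → Fin d → E) → ℝ}
    {Tk : Tor M → (Fin d → Fin n) → Fin n → Fin d → (E →L[ℂ] E)} :
    ∀ (φ : Tor M → Fin d → E) (W : Tor (fine n M) → Fin d → E), QvL n M Tk W = φ →
      (∀ W₂, QvL n M Tk W₂ = φ → ScV n M Rc G W ≤ ScV n M Rc G W₂) →
      ScV n M Rc G W + nsqV M (QvL n M Tk W) ≤ 1 * (ScV n M Rc G W + nsqV M φ) := by
  intro φ W hW _
  rw [hW, one_mul]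

end End

end Summit.QuantumFields.BalabanUV.T4Continuum.VariationalVectorOneMinCentredReg

end
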